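import Summits.AtomisticToContinuum.Crystallization.Theorems.HullExactificationCascadeZeroDefectDensityLocalStructureVertex
import HarnessLib

/-!
# Local structure of a soft twelve-shell — part 6/6: the rotation `σ` (stub `stub_localStructure`)
# (route `HullExactificationCascade`, crux `ZeroDefectDensity`, stmt-AtomisticToContinuum-12086;
# line `birth`)

The registered stub `stub_localStructure` of `Cruxes/ZeroDefectDensity/Lines/birth.lean` (lead c5
reshape), verbatim: twelve points `p i` about `u` with radii and soft contacts in
`[1 - 1/4000, 1 + 1/4000]`, non-contacts `≥ 7/5`, and the CENSUS (every `v` has exactly four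
contacts, exactly two pairs of which are in contact) carry a map `σ v` on the contacts of each `v`
which is a 4-cycle (clauses 1–3) with exactly two SMALL corners `a ~ σ v a` (clause 4), small
corners closing coherently into triangles (clause 5) and large corners into quadrilaterals
(clause 6).

Construction (parts 1–5; frame functions `R, P, D, S` as in `…LocalStructureFrame`, instantiated
here by their explicit formulas).  `rot_vertex` labels the four
contacts of `v` cyclically, `k₀ → k₁ → k₂ → k₃ → k₀`, all corners positively oriented in the
frame at `v` (triple product `T > 0`), large corners with `D ∈ [-0.40, -0.30]`, diagonals with
`|·|² ≥ 2.6`; `σ v` IS this 4-cycle (chosen once for all `v`).  Clauses 1–4 are then finite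
bookkeeping.  A successor is characterised by orientation and length (`T > 0`, `|x y|² < 2.6`:
`succ` in the proof), and the orientation is a triple product, invariant under the change of base
point (`rotT_cyclic`): this gives clause 5 at once, and clause 6 with the quad lemma `rot_quad`
(the `σ a`-predecessor `w` of `v` makes a LARGE corner `(w, v)` at `a` by clause 5, so
`|v w|² ∈ [1.94, 2.11]`, and `rot_quad` puts `w` within `7/5` of `b = σ v a`, hence in soft
contact by the dichotomy, with the corners at `b` and `w` positively oriented).

Mathlib + parts 1–5 only; no named fact is used. [folklore]
-/

noncomputable section

namespace Summit.AtomisticToContinuum.Crystallization.Theorems.ZeroDefectDensityBirth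

open scoped RealInnerProductSpace
open Literature.Geometry.DiscreteGeometry

/-! ## The stub -/

/-- **Local structure of a soft twelve-shell** (registered stub `stub_localStructure` of the birth
line, lead c5 reshape, verbatim).  Twelve points `p i` about `u` with radii and soft contacts in
`[1 - 1/4000, 1 + 1/4000]`, non-contacts `≥ 7/5`, every point with exactly four contacts exactly
two pairs of which are in contact, carry `σ : Fin 12 → Fin 12 → Fin 12` with: (1) `σ v` maps
contacts of `v` to other contacts of `v`, (2) injectively, (3) as a single 4-cycle, (4) with
exactly two small corners `a ~ σ v a`, (5) small corners closing coherently
(`σ a (σ v a) = v`, `σ (σ v a) v = a`) and (6) large corners closing into quadrilaterals.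
`σ v` is the counter-clockwise successor about the axis `u - p v` (`rot_vertex`). [folklore] -/
theorem stub_localStructure : ∀ (u : EuclideanSpace ℝ (Fin 3)) (p : Fin 12 → EuclideanSpace ℝ (Fin 3)), (∀ i : Fin 12, 1 - 1 / 4000 ≤ dist u (p i) ∧ dist u (p i) ≤ 1 + 1 / 4000) → (∀ i j : Fin 12, i ≠ j → 1 - 1 / 4000 ≤ dist (p i) (p j) ∧ (dist (p i) (p j) ≤ 1 + 1 / 4000 ∨ 7 / 5 ≤ dist (p i) (p j))) → (∀ i : Fin 12, {j : Fin 12 | j ≠ i ∧ dist (p i) (p j) ≤ 1 + 1 / 4000}.ncard = 4 ∧ {q : Fin 12 × Fin 12 | q.1 < q.2 ∧ q.1 ≠ i ∧ q.2 ≠ i ∧ dist (p i) (p q.1) ≤ 1 + 1 / 4000 ∧ dist (p i) (p q.2) ≤ 1 + 1 / 4000 ∧ dist (p q.1) (p q.2) ≤ 1 + 1 / 4000}.ncard = 2) → ∃ σ : Fin 12 → Fin 12 → Fin 12, (∀ v a : Fin 12, a ≠ v → dist (p v) (p a) ≤ 1 + 1 / 4000 → (σ v a ≠ v ∧ σ v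 a ≠ a ∧ dist (p v) (p (σ v a)) ≤ 1 + 1 / 4000)) ∧ (∀ v a b : Fin 12, a ≠ v → b ≠ v → dist (p v) (p a) ≤ 1 + 1 / 4000 → dist (p v) (p b) ≤ 1 + 1 / 4000 → σ v a = σ v b → a = b) ∧ (∀ v a : Fin 12, a ≠ v → dist (p v) (p a) ≤ 1 + 1 / 4000 → (σ v (σ v a) ≠ a ∧ σ v (σ v (σ v (σ v a))) = a)) ∧ (∀ v : Fin 12, {a : Fin 12 | a ≠ v ∧ dist (p v) (p a) ≤ 1 + 1 / 4000 ∧ dist (p a) (p (σ v a)) ≤ 1 + 1 / 4000}.ncard = 2) ∧ (∀ v a : Fin 12, a ≠ v → dist (p v) (p a) ≤ 1 + 1 / 4000 → dist (p a) (p (σ v a)) ≤ 1 + 1 / 4000 → (σ a (σ v a) = v ∧ σ (σ v a) v = a)) ∧ (∀ v a : Fin 12, a ≠ v → dist (p v) (p a) ≤ 1 + 1 / 4000 → ¬ dist (p a) (p (σ v a)) ≤ 1 + 1 / 4000 → ∃ w : Fin 12, w ≠ a ∧ w ≠ σ v a ∧ dist (p a) (p w) ≤ 1 + 1 / 4000 ∧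 σ a w = v ∧ dist (p w) (p (σ v a)) ≤ 1 + 1 / 4000 ∧ σ (σ v a) v = w ∧ σ w (σ v a) = a) := by
  intro u p H1 H2 H3
  have sym : ∀ i j : Fin 12, dist (p i) (p j) ≤ 1 + 1 / 4000 → dist (p j) (p i) ≤ 1 + 1 / 4000 :=
    fun i j h => by rwa [dist_comm]
  have sqlt : ∀ i j : Fin 12, dist (p i) (p j) ≤ 1 + 1 / 4000 →
      dist (p i) (p j) ^ 2 < 2.6 ∧ dist (p j) (p i) ^ 2 < 2.6 := by
    intro i j h
    rw [dist_comm (p j)]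
    have h0 : 0 ≤ dist (p i) (p j) := dist_nonneg
    constructor <;> nlinarith
  obtain ⟨R, P, D, S, hF⟩ := rot_frame_exists
  choose K0 K1 K2 K3 hK using fun v => rot_vertex hF u p H1 H2 v (H3 v).1 (H3 v).2
  obtain ⟨σ, hσ⟩ : ∃ σ : Fin 12 → Fin 12 → Fin 12, ∀ v a, σ v a =
      if a = K0 v then K1 v else if a = K1 v then K2 v else if a = K2 v then K3 v
      else if a = K3 v then K0 v else v := ⟨_, fun v a => rfl⟩
  have s0 : ∀ v, σ v (K0 v) = K1 v := fun v => by rw [hσ, if_pos rfl]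
  have s1 : ∀ v, σ v (K1 v) = K2 v := fun v => by
    obtain ⟨⟨n01, -⟩, -⟩ := hK v
    rw [hσ, if_neg n01.symm, if_pos rfl]
  have s2 : ∀ v, σ v (K2 v) = K3 v := fun v => by
    obtain ⟨⟨-, n02, -, n12, -⟩, -⟩ := hK v
    rw [hσ, if_neg n02.symm, if_neg n12.symm, if_pos rfl]
  have s3 : ∀ v, σ v (K3 v) = K0 v := fun v => by
    obtain ⟨⟨-, -, n03, -, n13, n23⟩, -⟩ := hK v
    rw [hσ, if_neg n03.symm, if_neg n13.symm, if_neg n23.symm, if_pos rfl]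
  -- forward facts along the cycle
  have fwd : ∀ v a : Fin 12, a ≠ v → dist (p v) (p a) ≤ 1 + 1 / 4000 →
      (σ v a ≠ v ∧ dist (p v) (p (σ v a)) ≤ 1 + 1 / 4000 ∧ σ v a ≠ a) ∧
      0 < orient3 (u - p v) (p a - p v) (p (σ v a) - p v) ∧
      (¬dist (p a) (p (σ v a)) ≤ 1 + 1 / 4000 →
        -0.40 ≤ D (u - p v) (p a - p v) (p (σ v a) - p v) ∧
          D (u - p v) (p a - p v) (p (σ v a) - p v) ≤ -0.30) := by
    intro v a hav hca
    obtain ⟨⟨n01, n02, n03, n12, n13, n23⟩, ⟨hk0, hk1, hk2, hk3⟩, cover, ⟨c01, f30, iff⟩, t01, t12,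
      t23, t30, w12, w23, w30, -, -⟩ := hK v
    rcases cover a hav hca with rfl | rfl | rfl | rfl
    · rw [s0]; exact ⟨⟨hk1.1, hk1.2, n01.symm⟩, t01, fun h => absurd c01 h⟩
    · rw [s1]; exact ⟨⟨hk2.1, hk2.2, n12.symm⟩, t12, w12⟩
    · rw [s2]; exact ⟨⟨hk3.1, hk3.2, n23.symm⟩, t23, w23⟩
    · rw [s3]; exact ⟨⟨hk0.1, hk0.2, n03⟩, t30, w30⟩
  -- a successor is characterised by orientation and length
  have succ : ∀ v x y : Fin 12, x ≠ v ∧ dist (p v) (p x) ≤ 1 + 1 / 4000 →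
      y ≠ v ∧ dist (p v) (p y) ≤ 1 + 1 / 4000 → 0 < orient3 (u - p v) (p x - p v) (p y - p v) →
      dist (p x) (p y) ^ 2 < 2.6 → σ v x = y := by
    intro v x y hx hy hT hd
    obtain ⟨-, -, cover, -, t01, t12, t23, t30, -, -, -, d02, d13⟩ := hK v
    rcases cover x hx.1 hx.2 with rfl | rfl | rfl | rfl <;>
      rcases cover y hy.1 hy.2 with rfl | rfl | rfl | rfl <;>
      first
      | exact s0 v
      | exact s1 v
      | exact s2 v
      | exact s3 v
      | exact absurd hT (by rw [orient3_self_right]; exact lt_irrefl 0)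
      | exact absurd hd (by linarith)
      | exact absurd hd (by rw [dist_comm]; linarith)
      | (exfalso; rw [orient3_swap_right] at hT; linarith)
  -- predecessors exist
  have pred : ∀ v y : Fin 12, y ≠ v → dist (p v) (p y) ≤ 1 + 1 / 4000 →
      ∃ x : Fin 12, x ≠ v ∧ dist (p v) (p x) ≤ 1 + 1 / 4000 ∧ σ v x = y := by
    intro v y hyv hcy
    obtain ⟨-, ⟨hk0, hk1, hk2, hk3⟩, cover, -⟩ := hK v
    rcases cover y hyv hcy with rfl | rfl | rfl | rfl
    exacts [⟨K3 v, hk3.1, hk3.2, s3 v⟩, ⟨K0 v, hk0.1, hk0.2, s0 v⟩, ⟨K1 v, hk1.1, hk1.2, s1 v⟩,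
      ⟨K2 v, hk2.1, hk2.2, s2 v⟩]
  -- clause 5
  have C5 : ∀ v a : Fin 12, a ≠ v → dist (p v) (p a) ≤ 1 + 1 / 4000 →
      dist (p a) (p (σ v a)) ≤ 1 + 1 / 4000 → σ a (σ v a) = v ∧ σ (σ v a) v = a := by
    intro v a hav hca hcs
    obtain ⟨⟨hbv, hcb, hba⟩, hT, -⟩ := fwd v a hav hca
    have Ta := hT
    rw [rotT_cyclic u (p v) (p a) (p (σ v a))] at Ta
    have Tb := Ta
    rw [rotT_cyclic u (p a) (p (σ v a)) (p v)] at Tb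
    exact ⟨succ a (σ v a) v ⟨hba, hcs⟩ ⟨hav.symm, sym _ _ hca⟩ Ta (sqlt _ _ hcb).2,
      succ (σ v a) v a ⟨hbv.symm, sym _ _ hcb⟩ ⟨hba.symm, sym _ _ hcs⟩ Tb (sqlt _ _ hca).1⟩
  refine ⟨σ, fun v a hav hca => ?_, ?_, ?_, ?_, C5, ?_⟩
  · -- clause 1
    obtain ⟨⟨h1, h2, h3⟩, -⟩ := fwd v a hav hca
    exact ⟨h1, h3, h2⟩
  · -- clause 2
    intro v a b hav hbv hca hcb h
    obtain ⟨⟨n01, n02, n03, n12, n13, n23⟩, -, cover, -⟩ := hK v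
    rcases cover a hav hca with rfl | rfl | rfl | rfl <;>
      rcases cover b hbv hcb with rfl | rfl | rfl | rfl <;>
      simp only [s0, s1, s2, s3] at h <;>
      first
      | rfl
      | exact absurd h n01 | exact absurd h n01.symm | exact absurd h n02 | exact absurd h n02.symm
      | exact absurd h n03 | exact absurd h n03.symm | exact absurd h n12 | exact absurd h n12.symm
      | exact absurd h n13 | exact absurd h n13.symm | exact absurd h n23 | exact absurd h n23.symm
  · -- clause 3
    intro v a hav hca
    obtain ⟨⟨n01, n02, n03, n12, n13, n23⟩, -, cover, -⟩ := hK v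
    rcases cover a hav hca with rfl | rfl | rfl | rfl <;> simp only [s0, s1, s2, s3]
    exacts [⟨n02.symm, trivial⟩, ⟨n13.symm, trivial⟩, ⟨n02, trivial⟩, ⟨n13, trivial⟩]
  · -- clause 4
    intro v
    obtain ⟨⟨n01, n02, n03, n12, n13, n23⟩, ⟨hk0, hk1, hk2, hk3⟩, cover, ⟨c01, f30, iff⟩, -⟩ := hK v
    by_cases hc : dist (p (K1 v)) (p (K2 v)) ≤ 1 + 1 / 4000
    · have : {a : Fin 12 | a ≠ v ∧ dist (p v) (p a) ≤ 1 + 1 / 4000 ∧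
          dist (p a) (p (σ v a)) ≤ 1 + 1 / 4000} = {K0 v, K1 v} := by
        ext a
        simp only [Set.mem_setOf_eq, Set.mem_insert_iff, Set.mem_singleton_iff]
        constructor
        · rintro ⟨hav, hca, hcs⟩
          rcases cover a hav hca with rfl | rfl | rfl | rfl
          · exact Or.inl rfl
          · exact Or.inr rfl
          · rw [s2] at hcs; exact absurd hcs (iff.mp hc)
          · rw [s3] at hcs; exact absurd hcs f30
        · rintro (rfl | rfl)
          · exact ⟨hk0.1, hk0.2, by rw [s0]; exact c01⟩
          · exact ⟨hk1.1, hk1.2, by rw [s1]; exact hc⟩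
      rw [this, Set.ncard_pair n01]
    · have hc' : dist (p (K2 v)) (p (K3 v)) ≤ 1 + 1 / 4000 := by
        by_contra h; exact hc (iff.mpr h)
      have : {a : Fin 12 | a ≠ v ∧ dist (p v) (p a) ≤ 1 + 1 / 4000 ∧
          dist (p a) (p (σ v a)) ≤ 1 + 1 / 4000} = {K0 v, K2 v} := by
        ext a
        simp only [Set.mem_setOf_eq, Set.mem_insert_iff, Set.mem_singleton_iff]
        constructor
        · rintro ⟨hav, hca, hcs⟩
          rcases cover a hav hca with rfl | rfl | rfl | rfl
          · exact Or.inl rfl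
          · rw [s1] at hcs; exact absurd hcs hc
          · exact Or.inr rfl
          · rw [s3] at hcs; exact absurd hcs f30
        · rintro (rfl | rfl)
          · exact ⟨hk0.1, hk0.2, by rw [s0]; exact c01⟩
          · exact ⟨hk2.1, hk2.2, by rw [s2]; exact hc'⟩
      rw [this, Set.ncard_pair n02]
  · -- clause 6
    intro v a hav hca hns
    obtain ⟨⟨hbv, hcb, hba⟩, hT, hwin⟩ := fwd v a hav hca
    obtain ⟨w1, w2⟩ := hwin hns
    obtain ⟨w, hwa, hcw, hsw⟩ := pred a v hav.symm (sym _ _ hca)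
    obtain ⟨-, hTa, hwina⟩ := fwd a w hwa hcw
    rw [hsw] at hTa hwina
    have nwv : ¬dist (p w) (p v) ≤ 1 + 1 / 4000 := fun h => by
      have e := (C5 a w hwa hcw (hsw ▸ h)).2
      rw [hsw] at e
      exact hns (e ▸ hcw)
    obtain ⟨wa1, wa2⟩ := hwina nwv
    have hVW := rot_vlarge hF (H1 a) (H1 w) ⟨(H2 a w hwa.symm).1, hcw⟩ (H1 v)
      ⟨(H2 a v hav).1, sym _ _ hca⟩ wa1 wa2
    rw [dist_comm] at hVW
    have tAW : 0 < orient3 (u - p v) (p a - p v) (p w - p v) := by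
      rwa [← rotT_cyclic u (p v) (p a) (p w)] at hTa
    obtain ⟨hd, tWB, tW⟩ := rot_quad hF (H1 v) (H1 a) ⟨(H2 v a hav.symm).1, hca⟩ (H1 (σ v a))
      ⟨(H2 v (σ v a) hbv.symm).1, hcb⟩ (H1 w) ⟨(H2 a w hwa.symm).1, hcw⟩ hVW w1 w2 hT tAW
    have nwb : w ≠ σ v a := fun h => hns (h ▸ hcw)
    have hcwb : dist (p w) (p (σ v a)) ≤ 1 + 1 / 4000 :=
      (H2 w (σ v a) nwb).2.resolve_right (by linarith)
    have hab2 := rot_vlarge hF (H1 v) (H1 a) ⟨(H2 v a hav.symm).1, hca⟩ (H1 (σ v a))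
      ⟨(H2 v (σ v a) hbv.symm).1, hcb⟩ w1 w2
    rw [dist_comm] at hab2
    rw [rotT_cyclic u (p v) (p w) (p (σ v a)), rotT_cyclic u (p w) (p (σ v a)) (p v)] at tWB
    exact ⟨w, hwa, nwb, hcw, hsw, hcwb,
      succ (σ v a) v w ⟨hbv.symm, sym _ _ hcb⟩ ⟨nwb, sym _ _ hcwb⟩ tWB (by linarith [hVW.2]),
      succ w (σ v a) a ⟨nwb.symm, hcwb⟩ ⟨hwa.symm, sym _ _ hcw⟩ tW (by linarith [hab2.2])⟩

end Summit.AtomisticToContinuum.Crystallization.Theorems.ZeroDefectDensityBirth
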